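import Literature.Probability.Percolation.QuadCrossingExplorationWalls
import HarnessLib

/-!
# Lower exit sets stay below upper walls — at arbitrary points of the free side

Topic `Probability/Percolation`; chart-level proofs file towards the named fact
`SchrammSmirnov2011_lemma_6_1` (`QuadCrossingContinuity.lean`; O. Schramm, S. Smirnov, *On the
scaling limits of planar percolation*, Ann. Probab. 39 (2011), arXiv:1101.5820, proof of Lemma 6.1,
cases (2)–(3)).

`QuadCrossingExplorationWalls.lean` proves, for the two-sided LOWEST/UPPERMOST open-crossing
exploration, that no point of the lower exit set lies above the upper wall.  The cut-free form of
the dual exploration of case (3) needs the same statement at the landing points of a low and a high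
DUAL crossing: `Charts.exitSet_not_mem_above_at` is `Charts.exitSet_not_mem_above` with the two wall
points replaced by arbitrary chart points `G(b, h)` and `G_T(b, h_T)` (`h + h_T ≤ 0`, i.e. the lower
point below the upper one along `∂₂Q'`) and the uppermost crossing replaced by any subset `L'` of
`[Q']` whose points on `∂₂Q'` have parameter `≥ 1 - (h_T + 1)/2`; the proof is verbatim.
Everything is proved.

## References

* O. Schramm, S. Smirnov, Ann. Probab. 39 (2011) 1768–1814, arXiv:1101.5820, proof of Lemma 6.1.
  [SchrammSmirnov2011]
-/

noncomputable section

open Set Metric Filter Function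
open _root_.Topology
open scoped unitInterval
open Literature.Probability.LatticeModels
open Literature.Topology.PlaneTopology

namespace Literature.Probability.Percolation

namespace SSContinuity

namespace Frame

variable (Φ : Frame) {D : Set ℂ} {Q Q' : QuadCrossing.Quad D}

variable {Φ} in
/-- **A lower exit set is not above an upper wall, at arbitrary side points** (see the module
docstring): `Charts.exitSet_not_mem_above` with the landing points of the lowest/uppermost open
crossings replaced by arbitrary chart points `G(b, h)`, `G_T(b, h_T)` of the free side with
`h + h_T ≤ 0`, and the uppermost crossing replaced by any `L' ⊆ [Q']` whose points on `∂₂Q'` have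
parameter `≥ 1 - (h_T + 1)/2` (e.g. a first-visit dual crossing landing at `G_T(b, h_T)`).
[cite: SchrammSmirnov2011, proof of Lemma 6.1, cases (2)–(3)] -/
theorem Charts.exitSet_not_mem_above_at (hΦ : Φ.Charts Q') (hb : Φ.b = 1) (hc : Φ.c = -1)
    (hd : Φ.d = 1) (hG : ∀ t : I, Φ.G ⟨1, 2 * (t : ℝ) - 1⟩ = Q' (1, t))
    (hcar : Q'.carrier ⊆ Q.carrier) (h1 : Q'.side 1 ⊆ Q.side 1)
    {h : ℝ} (hh : h ∈ Icc Φ.c Φ.d) {hT : ℝ} (hhT : hT ∈ Icc Φ.flipFrame.c Φ.flipFrame.d)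
    {L' : Set ℂ} (hL'Q' : L' ⊆ Q'.carrier)
    (hL'side : ∀ z ∈ L', ∀ θ : I, z = Q' (1, θ) → 1 - (hT + 1) / 2 ≤ (θ : ℝ))
    {ρ K : ℝ} (hρ : 0 ≤ ρ) (hK : 1 ≤ K)
    (harc : ∀ s t : I, dist (Q' (1, s)) (Q' (1, t)) ≤ ρ → ∀ u : I,
      ((s : ℝ) ≤ u ∧ (u : ℝ) ≤ t ∨ (t : ℝ) ≤ u ∧ (u : ℝ) ≤ s) → dist (Q' (1, u)) (Q' (1, s)) ≤ K * ρ)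
    {y₂ : ℂ} (α₀ : Path (Φ.G (⟨Φ.b, h⟩ : ℂ)) y₂)
    {E : Set ℂ} {M : ℝ} (hEQ : E ⊆ Q.carrier)
    (hEjoin : ∀ e ∈ E, ∃ p : Path (Φ.G (⟨Φ.b, h⟩ : ℂ)) e, range p ⊆ Q.carrier ∧
      ∀ s, dist (p s) (Φ.G (⟨Φ.b, h⟩ : ℂ)) ≤ K * ρ)
    (hE6 : E ∩ Q'.carrier ⊆ Q'.side 2)
    (hEM : ∀ u ∈ Φ.rect, u.re = Φ.b → Φ.G u ∈ E → u.im ≤ M) (hTM : h ≤ M)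
    (hMrect : (⟨Φ.b, M⟩ : ℂ) ∈ Φ.rect)
    (hMdist : dist (Φ.G ⟨Φ.b, M⟩) (Φ.G (⟨Φ.b, h⟩ : ℂ)) ≤ ρ)
    (hEanch : ∀ e ∈ E, e ∈ Φ.G '' {u | u ∈ Φ.rect ∧ u.re = Φ.b} ∨
      ∃ s t : I, (s : ℝ) ≤ t ∧ α₀ t = e ∧ α₀ s ∈ Q'.side 2 ∧
        ∀ u : I, (s : ℝ) ≤ u → (u : ℝ) ≤ t → α₀ u ∈ E)
    {E' : Set ℂ} {M' : ℝ}
    (hE'join : ∀ e ∈ E', ∃ p : Path (Φ.flipFrame.G (⟨Φ.flipFrame.b, hT⟩ : ℂ)) e,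
      range p ⊆ Q.carrier ∧ ∀ s, dist (p s) (Φ.flipFrame.G (⟨Φ.flipFrame.b, hT⟩ : ℂ)) ≤ K * ρ)
    (hE'M : ∀ u ∈ Φ.flipFrame.rect, u.re = Φ.flipFrame.b → Φ.flipFrame.G u ∈ E' → u.im ≤ M')
    (hTM' : hT ≤ M') (hM'rect : (⟨Φ.flipFrame.b, M'⟩ : ℂ) ∈ Φ.flipFrame.rect)
    (hM'dist : dist (Φ.flipFrame.G ⟨Φ.flipFrame.b, M'⟩)
      (Φ.flipFrame.G (⟨Φ.flipFrame.b, hT⟩ : ℂ)) ≤ ρ)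
    (hsum : h + hT ≤ 0)
    (hxx' : ∀ z : ℂ, (∃ p : Path (Φ.G (⟨Φ.b, h⟩ : ℂ)) z, range p ⊆ Q.carrier ∧
        ∀ s, dist (p s) (Φ.G (⟨Φ.b, h⟩ : ℂ)) ≤ K * ρ) →
      (∃ p : Path (Φ.flipFrame.G (⟨Φ.flipFrame.b, hT⟩ : ℂ)) z, range p ⊆ Q.carrier ∧
        ∀ s, dist (p s) (Φ.flipFrame.G (⟨Φ.flipFrame.b, hT⟩ : ℂ)) ≤ K * ρ) → False) :
    ∀ e ∈ E, e ∉ {z | z ∈ Q.carrier ∧ ∀ t ∈ Q.side 1, ∀ p : Path z t,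
      range p ⊆ Q.carrier → (range p ∩ (L' ∪ E')).Nonempty} := by
  set ΦT := Φ.flipFrame with hΦTdef
  have hΦT : ΦT.Charts Q'.flip := SSContinuity.Frame.Charts.flipFrame Φ hΦ
  have hGT : ∀ t : I, ΦT.G ⟨1, 2 * (t : ℝ) - 1⟩ = Q'.flip (1, t) := Φ.flipFrame_chart hG
  have hTb : ΦT.b = 1 := by simp [hΦTdef, hb]
  have hTc : ΦT.c = -1 := by simp [hΦTdef, hd]
  have hTd : ΦT.d = 1 := by simp [hΦTdef, hc]
  -- side points as points `Q'(1, θ)`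
  have hside : ∀ y : ℝ, y ∈ Icc Φ.c Φ.d → ∃ t : I, (t : ℝ) = (y + 1) / 2 ∧
      Φ.G ⟨Φ.b, y⟩ = Q' (1, t) := by
    intro y hy
    rw [hc, hd] at hy
    refine ⟨⟨(y + 1) / 2, ⟨by linarith [hy.1], by linarith [hy.2]⟩⟩, rfl, ?_⟩
    rw [← hG]
    congr 1
    apply Complex.ext <;> simp [hb]
    ring
  have hsideT : ∀ y : ℝ, y ∈ Icc ΦT.c ΦT.d → ∃ t : I, (t : ℝ) = (y + 1) / 2 ∧
      ΦT.G ⟨ΦT.b, y⟩ = Q' (1, σ t) := by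
    intro y hy
    rw [hTc, hTd] at hy
    refine ⟨⟨(y + 1) / 2, ⟨by linarith [hy.1], by linarith [hy.2]⟩⟩, rfl, ?_⟩
    rw [← QuadCrossing.Quad.flip_apply_one, ← hGT]
    congr 1
    apply Complex.ext <;> simp [hTb]
    ring
  -- parameters of side points are unique
  have hinj : ∀ θ₁ θ₂ : I, Q' (1, θ₁) = Q' (1, θ₂) → θ₁ = θ₂ := fun θ₁ θ₂ h =>
    (Prod.ext_iff.1 (Q'.injective_toFun h)).2
  have hside2 : ∀ z ∈ Q'.side 2, ∃ θ : I, z = Q' (1, θ) := by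
    rintro z hz
    obtain ⟨⟨s, θ⟩, hs, rfl⟩ := (show z ∈ Q' '' {z : I × I | z.1 = 1} from hz)
    simp only [mem_setOf_eq] at hs
    subst hs
    exact ⟨θ, rfl⟩
  have hmem2 : ∀ θ : I, Q' (1, θ) ∈ Q'.side 2 := fun θ => ⟨(1, θ), rfl, rfl⟩
  -- the two landing parameters
  have hTlow : h ∈ Icc (-1 : ℝ) 1 := by
    have := hh
    simpa [hc, hd] using this
  have hTup : hT ∈ Icc (-1 : ℝ) 1 := by
    have := hhT
    simpa [hTc, hTd] using this
  set tlow : I := ⟨(h + 1) / 2, ⟨by linarith [hTlow.1], by linarith [hTlow.2]⟩⟩ with htlow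
  set tup : I := ⟨(hT + 1) / 2, ⟨by linarith [hTup.1], by linarith [hTup.2]⟩⟩ with htup
  have hxlow : (Φ.G (⟨Φ.b, h⟩ : ℂ)) = Q' (1, tlow) := by
    rw [← hG tlow]
    congr 1
    apply Complex.ext
    · simp [hb]
    · simp [htlow]; ring
  have hxup : (ΦT.G (⟨ΦT.b, hT⟩ : ℂ)) = Q' (1, σ tup) := by
    rw [← QuadCrossing.Quad.flip_apply_one, ← hGT tup]
    congr 1
    apply Complex.ext
    · simp [hTb]
    · simp [htup]; ring
  have hsymm_tup : ((σ tup : I) : ℝ) = 1 - (tup : ℝ) := unitInterval.coe_symm_eq tup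
  have horder : (tlow : ℝ) ≤ (σ tup : I) := by
    rw [hsymm_tup]; simp only [htlow, htup]; linarith
  -- the top contact of `E` and the top contact of `E'` (flipped heights), as parameters
  obtain ⟨tM, htMe, hGM⟩ := hside M (by exact hMrect.2)
  have htlowM : (tlow : ℝ) ≤ tM := by rw [htMe]; simp only [htlow]; linarith
  have hdistM : dist (Q' (1, tlow)) (Q' (1, tM)) ≤ ρ := by
    rw [← hxlow, ← hGM, dist_comm]; exact hMdist
  obtain ⟨tM', htM'e, hGM'⟩ := hsideT M' (by exact hM'rect.2)
  have htupM' : (tup : ℝ) ≤ tM' := by rw [htM'e]; simp only [htup]; linarith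
  have hdistM' : dist (Q' (1, σ tup)) (Q' (1, σ tM')) ≤ ρ := by
    rw [← hxup, ← hGM', dist_comm]; exact hM'dist
  have hsymm_tM' : ((σ tM' : I) : ℝ) = 1 - (tM' : ℝ) := unitInterval.coe_symm_eq tM'
  -- arcs from `(Φ.G (⟨Φ.b, h⟩ : ℂ))` within `K ρ` of `(Φ.G (⟨Φ.b, h⟩ : ℂ))`, and from `(ΦT.G (⟨ΦT.b, hT⟩ : ℂ))` within `K ρ` of `(ΦT.G (⟨ΦT.b, hT⟩ : ℂ))`
  have harcpath : ∀ θ : I, (tlow : ℝ) ≤ θ → (θ : ℝ) ≤ tM →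
      ∃ p : Path (Φ.G (⟨Φ.b, h⟩ : ℂ)) (Q' (1, θ)), range p ⊆ Q.carrier ∧ ∀ s, dist (p s) (Φ.G (⟨Φ.b, h⟩ : ℂ)) ≤ K * ρ := by
    intro θ h₁ h₂
    refine ⟨(sideArc Q' tlow θ).cast hxlow rfl, ?_, fun s => ?_⟩
    · rintro _ ⟨s, rfl⟩
      rw [Path.cast_coe]
      obtain ⟨θ', hθ', -⟩ := range_sideArc_subset Q' tlow θ ⟨s, rfl⟩
      rw [hθ']; exact hcar (Q'.side_subset_carrier 2 (hmem2 θ'))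
    · rw [Path.cast_coe]
      obtain ⟨θ', hθ', hbet⟩ := range_sideArc_subset Q' tlow θ ⟨s, rfl⟩
      rw [hθ', hxlow]
      refine harc tlow tM hdistM θ' (Or.inl ?_)
      rcases hbet with h | h
      · exact ⟨h.1, h.2.trans h₂⟩
      · exact ⟨h₁.trans h.1, h.2.trans (h₁.trans h₂)⟩
  have harcpathT : ∀ θ : I, ((σ tM' : I) : ℝ) ≤ θ → (θ : ℝ) ≤ (σ tup : I) →
      ∃ p : Path (ΦT.G (⟨ΦT.b, hT⟩ : ℂ)) (Q' (1, θ)), range p ⊆ Q.carrier ∧ ∀ s, dist (p s) (ΦT.G (⟨ΦT.b, hT⟩ : ℂ)) ≤ K * ρ := by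
    intro θ h₁ h₂
    refine ⟨(sideArc Q' (σ tup) θ).cast hxup rfl, ?_, fun s => ?_⟩
    · rintro _ ⟨s, rfl⟩
      rw [Path.cast_coe]
      obtain ⟨θ', hθ', -⟩ := range_sideArc_subset Q' (σ tup) θ ⟨s, rfl⟩
      rw [hθ']; exact hcar (Q'.side_subset_carrier 2 (hmem2 θ'))
    · rw [Path.cast_coe]
      obtain ⟨θ', hθ', hbet⟩ := range_sideArc_subset Q' (σ tup) θ ⟨s, rfl⟩
      rw [hθ', hxup]
      refine harc (σ tup) (σ tM') hdistM' θ' (Or.inr ?_)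
      rcases hbet with h | h
      · exact ⟨h₁.trans (h₂.trans h.1), h.2.trans h₂⟩
      · exact ⟨h₁.trans h.1, h.2⟩
  -- a path and its reverse witness `hxx'`
  have hx'Q : (ΦT.G (⟨ΦT.b, hT⟩ : ℂ)) ∈ Q.carrier := by
    rw [hxup]; exact hcar (Q'.side_subset_carrier 2 (hmem2 _))
  have hxQ : (Φ.G (⟨Φ.b, h⟩ : ℂ)) ∈ Q.carrier := by
    rw [hxlow]; exact hcar (Q'.side_subset_carrier 2 (hmem2 _))
  have hrefl : ∀ z : ℂ, z ∈ Q.carrier → ∃ p : Path z z, range p ⊆ Q.carrier ∧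
      ∀ s, dist (p s) z ≤ K * ρ := fun z hz =>
    ⟨Path.refl z, by rintro _ ⟨s, rfl⟩; exact hz, fun s => by
      simp only [Path.refl_apply, dist_self]; positivity⟩
  -- CLAIM A: the top contact of `E` is below the upper landing point
  have hA : (tM : ℝ) < (σ tup : I) := by
    by_contra hcon
    push Not at hcon
    obtain ⟨p, hpQ, hp⟩ := harcpath (σ tup) horder hcon
    exact hxx' (ΦT.G (⟨ΦT.b, hT⟩ : ℂ)) ⟨p.cast rfl hxup, by rw [Path.cast_coe]; exact hpQ,
      fun s => by rw [Path.cast_coe]; exact hp s⟩ (hrefl (ΦT.G (⟨ΦT.b, hT⟩ : ℂ)) hx'Q)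
  -- CLAIM B: the top contact of `E'` (in flipped heights) is above the lower landing point
  have hB : (tlow : ℝ) < (σ tM' : I) := by
    by_contra hcon
    push Not at hcon
    obtain ⟨p, hpQ, hp⟩ := harcpathT tlow hcon horder
    exact hxx' (Φ.G (⟨Φ.b, h⟩ : ℂ)) (hrefl (Φ.G (⟨Φ.b, h⟩ : ℂ)) hxQ) ⟨p.cast rfl hxlow,
      by rw [Path.cast_coe]; exact hpQ, fun s => by rw [Path.cast_coe]; exact hp s⟩
  -- parameters of side points of `E`, of `L'` and of `E'`
  have hparE : ∀ z ∈ E, ∀ θ : I, z = Q' (1, θ) → (θ : ℝ) ≤ tM := by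
    intro z hz θ hzθ
    have hz2 : z ∈ Q'.side 2 := hzθ ▸ hmem2 θ
    rw [hΦ.side2] at hz2
    obtain ⟨u, ⟨hurect, hure⟩, rfl⟩ := hz2
    have hu : u = ⟨Φ.b, u.im⟩ := Complex.ext hure rfl
    obtain ⟨θu, hθu, hGu⟩ := hside u.im hurect.2
    have hle : u.im ≤ M := hEM u hurect hure hz
    have hθeq : θ = θu := hinj _ _ (by rw [← hzθ, ← hGu, ← hu])
    rw [hθeq, hθu, htMe]
    linarith
  have hparL' : ∀ z ∈ L', ∀ θ : I, z = Q' (1, θ) → ((σ tup : I) : ℝ) ≤ θ := by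
    intro z hz θ hzθ
    have := hL'side z hz θ hzθ
    rw [hsymm_tup]
    simp only [htup]
    linarith
  have hparE' : ∀ z ∈ E', ∀ θ : I, z = Q' (1, θ) → ((σ tM' : I) : ℝ) ≤ θ := by
    intro z hz θ hzθ
    have hz2 : z ∈ Q'.flip.side 2 := by
      rw [QuadCrossing.Quad.flip_side_two, hzθ]; exact hmem2 θ
    rw [hΦT.side2] at hz2
    obtain ⟨u, ⟨hurect, hure⟩, rfl⟩ := hz2
    have hle : u.im ≤ M' := hE'M u hurect hure hz
    have hu : u = ⟨ΦT.b, u.im⟩ := Complex.ext hure rfl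
    obtain ⟨θu, hθu, hGu⟩ := hsideT u.im hurect.2
    have hθeq : θ = σ θu := hinj _ _ (by rw [← hzθ, ← hGu, ← hu])
    rw [hθeq, hsymm_tM', unitInterval.coe_symm_eq, hθu, htM'e]
    linarith
  -- (W3) `E` misses the uppermost crossing, (W4) `E` misses `E'`
  have hEL' : ∀ z ∈ E, z ∉ L' := by
    intro z hzE hzL'
    have hzQ' : z ∈ Q'.carrier := hL'Q' hzL'
    obtain ⟨θ, hθ⟩ := hside2 z (hE6 ⟨hzE, hzQ'⟩)
    have h₁ := hparE z hzE θ hθ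
    have h₂ := hparL' z hzL' θ hθ
    linarith
  have hEE' : ∀ z ∈ E, z ∉ E' := fun z hzE hzE' =>
    hxx' z (hEjoin z hzE) (hE'join z hzE')
  -- the descent along `∂₂Q'` from a contact of `E` to the corner `Q'(1,0) ∈ ∂₁Q`
  have hcorner : Q' (1, 0) ∈ Q.side 1 := h1 ⟨(1, 0), rfl, rfl⟩
  have hdesc : ∀ θ : I, (θ : ℝ) ≤ tM →
      ∀ s, (sideArc Q' θ 0) s ∉ L' ∪ E' := by
    intro θ hθM s hs
    obtain ⟨θ', hθ', hbet⟩ := range_sideArc_subset Q' θ 0 ⟨s, rfl⟩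
    have hθ'le : (θ' : ℝ) ≤ θ := by
      rcases hbet with h | h
      · have : ((0 : I) : ℝ) = 0 := rfl
        have h0 : (θ' : ℝ) ≤ 0 := by simpa using h.2
        linarith [θ'.2.1, θ.2.1]
      · exact h.2
    rcases hs with hs | hs
    · have := hparL' _ hs θ' hθ'
      linarith
    · have hge := hparE' _ hs θ' hθ'
      -- `θ'` lies strictly above `tlow` and below `tM`: the arc from `(Φ.G (⟨Φ.b, h⟩ : ℂ))` reaches it within `K ρ`
      obtain ⟨p, hpQ, hp⟩ := harcpath θ' (by linarith) (hθ'le.trans hθM)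
      exact hxx' _ ⟨p.cast rfl hθ', by rw [Path.cast_coe]; exact hpQ,
        fun s => by rw [Path.cast_coe]; exact hp s⟩ (hE'join _ hs)
  have hrange_desc : ∀ θ : I, range (sideArc Q' θ 0) ⊆ Q.carrier := by
    rintro θ _ ⟨s, rfl⟩
    obtain ⟨θ', hθ', -⟩ := range_sideArc_subset Q' θ 0 ⟨s, rfl⟩
    rw [hθ']; exact hcar (Q'.side_subset_carrier 2 (hmem2 θ'))
  -- conclusion
  intro e he heM
  obtain ⟨-, hall⟩ := heM
  rcases hEanch e he with hside_e | ⟨s₀, t₀, hst, hte, hs2, hseg⟩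
  · -- `e` is a side point of `E`
    have he2 : e ∈ Q'.side 2 := by
      obtain ⟨u, hu, rfl⟩ := hside_e
      rw [hΦ.side2]; exact ⟨u, hu, rfl⟩
    obtain ⟨θ, hθ⟩ := hside2 e he2
    have hθM : (θ : ℝ) ≤ tM := hparE e he θ hθ
    subst hθ
    obtain ⟨z, ⟨s, rfl⟩, hzW⟩ := hall (Q' (1, 0)) hcorner (sideArc Q' θ 0) (hrange_desc θ)
    exact hdesc θ hθM s hzW
  · -- `e` is anchored: back along `α₀` inside `E`, then descend from the anchor
    set c := α₀ s₀ with hc'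
    obtain ⟨θ, hθ⟩ := hside2 c hs2
    have hcE : c ∈ E := hseg s₀ le_rfl hst
    have hθM : (θ : ℝ) ≤ tM := hparE c hcE θ hθ
    -- the piece of `α₀` from `t₀` back to `s₀`
    have hmaps : ∀ u ∈ Icc (0 : ℝ) 1, (t₀ : ℝ) + u * ((s₀ : ℝ) - t₀) ∈ Icc (0 : ℝ) 1 := fun u hu =>
      ⟨by nlinarith [hu.1, hu.2, s₀.2.1, t₀.2.1], by nlinarith [hu.1, hu.2, s₀.2.2, t₀.2.2]⟩
    let back : Path e c :=
      { toFun := fun u => α₀.extend ((t₀ : ℝ) + (u : ℝ) * ((s₀ : ℝ) - t₀))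
        continuous_toFun := α₀.continuous_extend.comp (by fun_prop)
        source' := by simp [← hte]
        target' := by simp [hc'] }
    have hback : ∀ u : I, back u ∈ E := fun u => by
      have hmem := hmaps u u.2
      show α₀.extend ((t₀ : ℝ) + (u : ℝ) * ((s₀ : ℝ) - t₀)) ∈ E
      rw [α₀.extend_apply hmem]
      refine hseg ⟨_, hmem⟩ ?_ ?_
      · show (s₀ : ℝ) ≤ (t₀ : ℝ) + (u : ℝ) * ((s₀ : ℝ) - t₀); nlinarith [u.2.1, u.2.2]
      · show (t₀ : ℝ) + (u : ℝ) * ((s₀ : ℝ) - t₀) ≤ t₀; nlinarith [u.2.1, u.2.2]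
    let full : Path e (Q' (1, 0)) := back.trans ((sideArc Q' θ 0).cast hθ rfl)
    have hfullQ : range full ⊆ Q.carrier := by
      rw [Path.trans_range]
      refine union_subset ?_ ?_
      · rintro _ ⟨u, rfl⟩; exact hEQ (hback u)
      · rintro _ ⟨u, rfl⟩
        rw [Path.cast_coe]
        exact hrange_desc θ ⟨u, rfl⟩
    obtain ⟨z, hz, hzW⟩ := hall (Q' (1, 0)) hcorner full hfullQ
    rw [Path.trans_range] at hz
    rcases hz with ⟨u, rfl⟩ | ⟨u, rfl⟩
    · rcases hzW with h | h
      · exact hEL' _ (hback u) h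
      · exact hEE' _ (hback u) h
    · rw [Path.cast_coe] at hzW
      exact hdesc θ hθM u hzW

end Frame

end SSContinuity

end Literature.Probability.Percolation
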